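import Summits.BirchSwinnertonDyer.BirchSwinnertonDyer.Theorems.GenusKolyvaginAtTwoGenusPrimitiveSupplyAtTwoLoweringStep
import Summits.BirchSwinnertonDyer.BirchSwinnertonDyer.Theorems.GenusKolyvaginAtTwoEquivariantKolyvaginExactAtTwoLocalTorsionCount
import HarnessLib

/-!
# Route `GenusKolyvaginAtTwo`, residual `OffCutResidualAtTwoR` (stmt-BirchSwinnertonDyer-31767), LINE 24 «strict_def2» stub A⁼² /
# LINE 27 `stub_residual` slice 3: MAZUR–RUBIN'S LOWERING STEP AT `p = 2` WITH THE IDENTITY PRIME EXPORTED (`#E(ℚ_p)[2] = 4`)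

Seat `bsd-line-gk2-p5` g39 (WIDTH-5 attach, cell `bsd-f1-sign2`), `--supports stmt-BirchSwinnertonDyer-31767` (helper; closes nothing).
THEOREMS ONLY (no definition, no named fact, no `sorry`).  BSD is NOT proved by any of this; no item is closed.  First of two files
(sequel `…OffCutResidualAtTwoRStrictDefTwoSupply`: the defect-2 minimal twin on the STRICT cell and stub A⁼² verbatim).

WHAT.  LEAD gk2-p1 g8's lowering step `GenusKolyLowering.exists_prime_card_selmerGroup_quadraticTwist_mul_four_eq` (Mazur–Rubin 2010
Prop. 5.2 at `p = 2`, Selmer form: a prime `p ≡ 1 (mod m)` with `#Sel₂(W^{(p)})·4 = #Sel₂(W)`) forgets that its twisting prime is an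
IDENTITY prime (`Frob_p = 1` on `E[2]`, i.e. `E[2] ⊂ E(ℚ_p)`).  The defect-2 supply of LINE 24 needs exactly that bit (Kramer:
`c_p(E^{(d)}) = #E(ℚ_p)[2] = 4` at a ramified identity prime `p` of `d`).  This file re-runs the LEAD's assembly VERBATIM and keeps it:
* `exists_identityPrime_card_selmerGroup_quadraticTwist_mul_four_eq` — same hypotheses and conclusion as the LEAD's theorem PLUS
  `#W(ℚ_p)[2] = 4` (`ReductionCyclic.natCard_ker_zsmul_adicCompletion_eq`: `#E(ℚ_v)[2] = #E[2]^{Φ}` with `Φ` the conjugate of the split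
  Frobenius `t` of `exists_splitTwistingPrime_pair` above the chosen embedding, then `ℚ_v ≅ ℚ_p`).

References: [MazurRubin2010] Prop. 5.2 (proof, arXiv:0904.3709 p. 12), Lemma 3.6, Cor. 3.4 (i); [MilneADT2006] I Lemma 3.3, Thm. 4.10;
[SilvermanAEC2009] VII.4.1(a), VII.5.1(a).
-/

set_option linter.dupNamespace false -- tree convention: `Summit.BirchSwinnertonDyer.BirchSwinnertonDyer.Theorems` (summit = sub-problem)
set_option autoImplicit false

noncomputable section

open scoped Classical ContRepresentation

namespace Summit.BirchSwinnertonDyer.BirchSwinnertonDyer.Theorems.GenusKolyLowering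

open WeierstrassCurve Field NumberField IsDedekindDomain Function
open Literature.NumberTheory.EllipticCurves Literature.NumberTheory.GaloisRepresentations
open Literature.NumberTheory.GaloisCohomology Literature.NumberTheory
open Rat.HeightOneSpectrum
open Summit.BirchSwinnertonDyer.BirchSwinnertonDyer.Theorems.GenusKolyTwistingPrime (primesEquiv_eq natCast_not_mem_of_not_dvd)
open Summit.BirchSwinnertonDyer.BirchSwinnertonDyer.Theorems.GenusKolyTwistRamified
  (valuation_natCast_eq_exp_neg_one_of_mem exists_uniformizer_sq_mul_of_valuation_eq)
open Summit.BirchSwinnertonDyer.BirchSwinnertonDyer.Theorems.GenusExact.ReductionCyclic (natCard_ker_zsmul_adicCompletion_eq)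

section Step

variable (W : WeierstrassCurve ℚ) [W.IsElliptic] [W.IsGloballyMinimal]

/-- **THE LOWERING STEP AT AN IDENTITY PRIME (Mazur–Rubin Prop. 5.2, Selmer form, `ρ̄₂` onto), identity exported.**  For `W/ℚ`
globally minimal with `ρ̄_{W,2}` onto, two distinct non-zero classes `x, y ∈ Sel₂(W)` and `m ≥ 1`, there is a prime `p` with
`p ≡ 1 (mod m)`, `p ∤ 2m`, `W` good at `p`, **`#W(ℚ_p)[2] = 4`** (the split twisting prime is an identity prime: its Frobenius
fixes `E[2]`), and `#Sel₂(W^{(p)}) · 4 = #Sel₂(W)` for the model `W.quadraticTwist p`.  Proof = LEAD gk2-p1 g8's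
`exists_prime_card_selmerGroup_quadraticTwist_mul_four_eq` verbatim, keeping the Frobenius `t` of `exists_splitTwistingPrime_pair`
(`t • P = P` on `E[2]`) and reading `#E(ℚ_v)[2] = #E[2]^{Φ}` at the conjugate `Φ` of `t` above the chosen embedding (Milne I Lemma 3.3).
[cite: MazurRubin2010, Prop. 5.2 and its proof (arXiv:0904.3709 p. 12), Cor. 3.4 (i), Lemma 3.6]
[cite: MilneADT2006, Ch. I, Lemma 3.3 and Thm. 4.10] [cite: SilvermanAEC2009, VII.4 Prop. 4.1(a), VII.5 Prop. 5.1(a)] -/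
theorem exists_identityPrime_card_selmerGroup_quadraticTwist_mul_four_eq
    (hPT : poitouTate_selmerStructure_duality_real ℚ)
    (hEP : ∀ v : HeightOneSpectrum (𝓞 ℚ), localEulerPoincareCharacteristic (v.adicCompletion ℚ))
    (hsurj : W.HasSurjectiveModNGaloisRep 2)
    {x y : galH1Torsion W (2 : ℤ)} (hxS : x ∈ W.selmerGroup 2) (hyS : y ∈ W.selmerGroup 2)
    (hx : x ≠ 0) (hy : y ≠ 0) (hxy : x ≠ y) {m : ℕ} (hm : m ≠ 0) :
    ∃ p : ℕ, p.Prime ∧ (p : ℤ) ≡ 1 [ZMOD (m : ℤ)] ∧ ¬ p ∣ 2 * m ∧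
      (∀ _h : Fact p.Prime, W.HasGoodReductionAtPrime p) ∧
      (∀ _h : Fact p.Prime, Nat.card {Q : (W.baseChange ℚ_[p]).toAffine.Point // 2 • Q = 0} = 4) ∧
      Nat.card ((W.quadraticTwist (p : ℚ)).selmerGroup 2) * 4 = Nat.card (W.selmerGroup 2) := by
  classical
  -- ### the finite set of bad places and the place of `2`
  have hbadfin : {v : HeightOneSpectrum (𝓞 ℚ) | ¬ W.HasGoodReductionAt v}.Finite := by
    have h := W.eventually_hasGoodReductionAt
    rwa [Filter.eventually_cofinite] at h
  have h2fin : {v : HeightOneSpectrum (𝓞 ℚ) | ((2 : ℕ) : 𝓞 ℚ) ∈ v.asIdeal}.Finite :=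
    Set.Subsingleton.finite fun v hv v' hv' ↦ HeightOneSpectrum.eq_of_natCast_mem_rat Nat.prime_two hv hv'
  set S' : Set (HeightOneSpectrum (𝓞 ℚ)) :=
    {v | ¬ W.HasGoodReductionAt v} ∪ {v | ((2 : ℕ) : 𝓞 ℚ) ∈ v.asIdeal} with hS'
  have hS'fin : S'.Finite := hbadfin.union h2fin
  -- ### the modulus `8 · m · ∏_{q bad} q`
  set Bad : Finset ℕ := hbadfin.toFinset.image (fun v ↦ (primesEquiv v : ℕ)) with hBad
  set M : ℕ := ∏ q ∈ Bad, q with hM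
  have hM0 : M ≠ 0 := Finset.prod_ne_zero_iff.mpr fun q hq ↦ by
    obtain ⟨v, -, rfl⟩ := Finset.mem_image.mp hq
    exact (primesEquiv v).2.ne_zero
  set m₀ : ℕ := 8 * m * M with hm₀
  have hm₀0 : m₀ ≠ 0 := mul_ne_zero (mul_ne_zero (by norm_num) hm) hM0
  -- ### the split twisting prime, WITH its Frobenius `t` fixing `E[2]`
  obtain ⟨p, hpF, -, hpm₀, hmod, v, 𝔓, t, hvS', hpv, h𝔓, ht, -, -, htfix, -, -, -, hxloc, hyloc, hxyloc, hsubloc⟩ :=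
    exists_splitTwistingPrime_pair W hsurj hx hy hxy ⊤ (by simp) (fun _ _ ↦ Subgroup.mem_top _)
      hm₀0 ∅ hS'fin
  have hp : p.Prime := hpF.out
  have hgood : W.HasGoodReductionAt v := by
    by_contra h; exact hvS' (Or.inl h)
  have h2v : ((2 : ℕ) : 𝓞 ℚ) ∉ v.asIdeal := fun h ↦ hvS' (Or.inr h)
  have hp2 : p ≠ 2 := by rintro rfl; exact h2v hpv
  -- congruences extracted from `p ≡ 1 (mod 8 m M)`
  have hmod8 : (p : ℤ) % 8 = 1 := by
    have h := hmod.of_dvd (show ((8 : ℕ) : ℤ) ∣ (m₀ : ℤ) by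
      rw [hm₀]; exact_mod_cast (dvd_mul_right 8 m).mul_right M)
    have h' := Int.ModEq.eq h
    norm_num at h'
    omega
  have hmodm : (p : ℤ) ≡ 1 [ZMOD (m : ℤ)] :=
    hmod.of_dvd (by rw [hm₀]; exact_mod_cast (dvd_mul_left m 8).mul_right M)
  have hmodq : ∀ q ∈ Bad, (p : ℤ) ≡ 1 [ZMOD (q : ℤ)] := fun q hq ↦
    hmod.of_dvd (by rw [hm₀]; exact_mod_cast (Finset.dvd_prod_of_mem _ hq).mul_left (8 * m))
  have hpm : ¬ p ∣ 2 * m := fun h ↦ hpm₀ (by rw [hm₀, show 8 * m * M = 2 * m * (4 * M) by ring]; exact h.mul_right _)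
  -- ### the identity clause: `#W(ℚ_p)[2] = #E[2]^{Φ} = 4`
  have hident : ∀ _h : Fact p.Prime, Nat.card {Q : (W.baseChange ℚ_[p]).toAffine.Point // 2 • Q = 0} = 4 := by
    intro _
    have hvp : ((primesEquiv v : Nat.Primes) : ℕ) = p := primesEquiv_eq hp hpv
    -- move `t` to the prime of the chosen embedding `ℚ̄ → ℚ̄_v`
    have h𝔓₀ := adicCompletionPrime_mem_primesAbove ℚ v
    obtain ⟨g, hg⟩ := HeightOneSpectrum.exists_smul_eq_of_mem_primesAbove_holds h𝔓 h𝔓₀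
    have hΦ : IsArithFrobAt (𝓞 ℚ) (g * t * g⁻¹) (adicCompletionPrime ℚ v) := hg ▸ ht.conj g
    have hnv : (((2 : ℤ)) : 𝓞 ℚ) ∉ v.asIdeal := by
      intro hmem
      exact h2v (by exact_mod_cast hmem)
    have hker := natCard_ker_zsmul_adicCompletion_eq W (n := (2 : ℤ)) two_ne_zero hgood hnv hΦ
    have hfix : Nat.card {P : geomTorsion W (2 : ℤ) // (g * t * g⁻¹) • P = P} = 4 := by
      rw [← GenusKolyTwistingPrime.natCard_geomTorsion_two_rat W]
      refine Nat.card_congr (Equiv.subtypeUnivEquiv fun P ↦ ?_)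
      rw [mul_smul, mul_smul, htfix (g⁻¹ • P), smul_inv_smul]
    have hzn : Nat.card (zsmulAddGroupHom (2 : ℤ) : (W.baseChange (v.adicCompletion ℚ)).toAffine.Point →+ _).ker =
        Nat.card (nsmulAddMonoidHom 2 : (W.baseChange (v.adicCompletion ℚ)).toAffine.Point →+ _).ker := by
      refine Nat.card_congr (Equiv.subtypeEquivRight fun Q ↦ ?_)
      simp only [AddMonoidHom.mem_ker, zsmulAddGroupHom_apply, nsmulAddMonoidHom_apply]
      rw [show (2 : ℤ) = ((2 : ℕ) : ℤ) from rfl, natCast_zsmul]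
    rw [hfix, hzn, GenusKolyTwistLocal.natCard_ker_nsmul_adicCompletion_eq_padic W v 2] at hker
    subst hvp
    exact hker
  -- ### the twist and its good reduction away from `2 p Δ`
  have hp0 : (p : ℚ) ≠ 0 := by exact_mod_cast hp.ne_zero
  haveI := W.isElliptic_quadraticTwist hp0
  have hΔ : ∀ (q : ℕ) [Fact q.Prime] (w : HeightOneSpectrum (𝓞 ℚ)), (q : 𝓞 ℚ) ∈ w.asIdeal →
      W.HasGoodReductionAt w → ¬ (q : ℤ) ∣ minimalDiscriminantInt W := fun q _ w hqw hw ↦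
    W.not_dvd_minimalDiscriminantInt_of_hasGoodReductionAtPrime q
      (W.hasGoodReductionAtPrime_of_hasGoodReductionAt w hqw hw)
  -- ### the Selmer count
  have hcount := natCard_selmerGroup_twist_mul_four_eq_of_places W hPT hEP hp0 (Wd := W.quadraticTwist (p : ℚ))
    (C := 1) (one_smul _ _) v h2v hgood
    (exists_uniformizer_sq_mul_of_valuation_eq v (valuation_natCast_eq_exp_neg_one_of_mem v hp hpv)) ?_ ?_ ?_
  · refine ⟨p, hp, hmodm, hpm, fun _ ↦ W.hasGoodReductionAtPrime_of_hasGoodReductionAt v hpv hgood, hident, ?_⟩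
    exact hcount
  · -- finite places `w ≠ v`
    intro w hw
    by_cases h2w : ((2 : ℕ) : 𝓞 ℚ) ∈ w.asIdeal
    · exact Or.inl (exists_sq_eq_adicCompletion_of_mod_eight w h2w hmod8)
    by_cases hbad : W.HasGoodReductionAt w
    · -- good odd place `≠ v`: both curves good
      refine Or.inr (Or.inl ⟨h2w, hbad, ?_⟩)
      haveI hF : Fact (primesEquiv w : ℕ).Prime := ⟨(primesEquiv w).2⟩
      have hqw : ((primesEquiv w : ℕ) : 𝓞 ℚ) ∈ w.asIdeal := by
        have h := (natGenerator_dvd_iff (R := 𝓞 ℚ) w (n := (primesEquiv w : ℕ))).mp dvd_rfl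
        rw [Ideal.mem_map_iff_of_surjective _ (Rat.IsIntegralClosure.intEquiv (𝓞 ℚ)).surjective] at h
        obtain ⟨z, hz, hzq⟩ := h
        have : z = ((primesEquiv w : ℕ) : 𝓞 ℚ) :=
          (Rat.IsIntegralClosure.intEquiv (𝓞 ℚ)).injective (by rw [hzq, map_natCast])
        rwa [this] at hz
      have hq2 : (primesEquiv w : ℕ) ≠ 2 := fun h ↦ h2w (by rw [← h]; exact hqw)
      have hqp : (primesEquiv w : ℕ) ≠ p := fun h ↦ hw
        (HeightOneSpectrum.eq_of_natCast_mem_rat hp (by rw [← h]; exact hqw) hpv)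
      have hpd : ¬ ((primesEquiv w : ℕ) : ℤ) ∣ 2 * (p : ℤ) := by
        intro h
        have h' : (primesEquiv w : ℕ) ∣ 2 * p := by exact_mod_cast h
        rcases (Nat.Prime.dvd_mul hF.out).mp h' with h2 | hpp
        · exact hq2 ((Nat.prime_dvd_prime_iff_eq hF.out Nat.prime_two).mp h2)
        · exact hqp ((Nat.prime_dvd_prime_iff_eq hF.out hp).mp hpp)
      have h := W.hasGoodReductionAt_quadraticTwist w hpd (hΔ _ w hqw hbad)
      rwa [Int.cast_natCast] at h
    · -- bad place: `p ≡ 1 (mod q)` splits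
      haveI hF : Fact (primesEquiv w : ℕ).Prime := ⟨(primesEquiv w).2⟩
      have hqw : ((primesEquiv w : ℕ) : 𝓞 ℚ) ∈ w.asIdeal := by
        have h := (natGenerator_dvd_iff (R := 𝓞 ℚ) w (n := (primesEquiv w : ℕ))).mp dvd_rfl
        rw [Ideal.mem_map_iff_of_surjective _ (Rat.IsIntegralClosure.intEquiv (𝓞 ℚ)).surjective] at h
        obtain ⟨z, hz, hzq⟩ := h
        have : z = ((primesEquiv w : ℕ) : 𝓞 ℚ) :=
          (Rat.IsIntegralClosure.intEquiv (𝓞 ℚ)).injective (by rw [hzq, map_natCast])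
        rwa [this] at hz
      have hq2 : (primesEquiv w : ℕ) ≠ 2 := fun h ↦ h2w (by rw [← h]; exact hqw)
      have hqBad : (primesEquiv w : ℕ) ∈ Bad := Finset.mem_image.mpr ⟨w, hbadfin.mem_toFinset.mpr hbad, rfl⟩
      exact Or.inl (exists_sq_eq_adicCompletion_of_modEq_one w hF.out hq2 hqw (hmodq _ hqBad))
  · -- the infinite place splits (`p > 0`)
    exact fun w ↦ Or.inl (exists_sq_eq_infinitePlace_completion w p)
  · -- the two classes, in the Selmer-structure currency
    have hres : ∀ z : galH1Torsion W ((2 : ℕ) : ℤ), z ∉ W.torsionLocalKer (v.adicCompletion ℚ) ((2 : ℕ) : ℤ) →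
        galoisCohomology.localization (W.torsionGaloisModule ((2 : ℕ) : ℤ)) (Sum.inr v) 1 z ≠ 0 := fun z hz h ↦
      hz ((GenusKolyTwistLocal.mem_torsionLocalKer_iff_localization_eq_zero_rat W v z).mpr h)
    refine ⟨x, ?_, y, ?_, hres x hxloc, hres y hyloc, ?_, hres (x + y) hxyloc⟩
    · rw [← selmerGroup_eq_selmerGroup_kummerSelmerStructure]; exact hxS
    · rw [← selmerGroup_eq_selmerGroup_kummerSelmerStructure]; exact hyS
    · intro h
      exact hres (x - y) hsubloc
        ((map_sub (galoisCohomology.localization (W.torsionGaloisModule ((2 : ℕ) : ℤ)) (Sum.inr v) 1) x y).trans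
          (sub_eq_zero.mpr h))

end Step

end Summit.BirchSwinnertonDyer.BirchSwinnertonDyer.Theorems.GenusKolyLowering

end
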